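import Summits.BirchSwinnertonDyer.BirchSwinnertonDyer.Theorems.PrintCf2RubinValueTwoRowTwoTwistedKummerLaws
import Literature.NumberTheory.ComplexMultiplication.EllipticUnits.ImaginaryQuadraticMainConjectureCarriersCores
import Literature.NumberTheory.EllipticCurves.Kato2004.IwasawaCohomologyNumberFieldTwistModel
import Literature.NumberTheory.GaloisRepresentations.EulerSystem
import HarnessLib

/-!
# M-LINE-PIN / (α3) ROW 2, FILE 8e: the RESTRICTED TOWERS `res_{F} (I.proj n k h)` — reduction, invariance under `Gal(K̄/K̃_n)`, and the
# action of `(1+T_i)^M − 1` on ty2's pinned `H¹` read as `conj_{γ_i^M} − 1` on the layers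

Cell `bsd-print-cf2`, WIDTH seat `bsd-line-cf2-p1-w6` g10 (prover-bsd-line-cf2-p1-w6-g10-0), successor of g9 on (α3) ROW 2 of the JLK road on the
DECIDING child stmt-BirchSwinnertonDyer-24721 `PrintCf2RubinValueTwo.MainConjClauseAtSplitTwoQuadDA` (memo `HOME/bsd-line-cf2-p1-w6/ROW2-RHO3-SPEC-w6g9.md`
§2 (C-d)/(C-f): plumbing of the COKERNEL half `hgcoker` of g8's FILE 4a); `--supports` that item (helper, Theses-free). HONEST FRAMING: functoriality
of continuous cohomology (the tree's `resLe`, `conjMap`) and ty2's pins (P2), (P5), (P6); nothing here closes the crux or a registered stub; no summit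
statement is proved by this seat; BSD is not proved by any of this. THEOREMS ONLY (no definition, no named fact, no instance, no `sorry`).

WHAT. `U ≤ V ≤ Γ_K`, `res : H¹(V_S, μ_{p^k} ⊗ θ′) → H¹(U_S, μ_{p^k} ⊗ θ′)` the tree's `resLe` in ty2's level currency.
* §1 `levelRed_resLe` (`red ∘ res = res ∘ red`), `levelConj_resLe` (`res (δ·c) = δ·res c`, tree `Kato2004.resLe_conjMap`), `levelConj_eq_self_of_mem`
  (`δ ∈ V` acts trivially on `H¹(V_S, ·)`, tree `conjMap_one_apply_of_mem`), hence `levelConj_resLe_eq_self_of_mem`: THE RESTRICTION TO `U` OF A CLASS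
  OF `V` IS `V`-INVARIANT; `levelConj_mul` (the action is multiplicative in `γ`).
* §2 `proj_one_add_X_pow_smul` / `proj_one_add_CX_pow_smul`: on ty2's pinned `I : IwasawaCohomologyData`, `I.proj n k ((1+T₁)^M • h) = conj_{γ₁^M}(I.proj n k h)`
  and the same for `T₂ = C X`, `γ₂` ((P5)/(P6) iterated); so `(1+T_i)^M − 1` acts on the layer `(n, k)` as `conj_{γ_i^M} − 1`.
* §3 `levelRed_resLe_proj` / `levelConj_resLe_proj_eq_self`: for `h ∈ I.H` and `U ≤ Gal(K̄/K̃_n)`, `k ↦ res_U (I.proj n k h)` is a `k`-TOWER (FILE 8b's input)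
  invariant under every `δ ∈ Gal(K̄/K̃_n)` (FILE 8c's input at the ramified places, FILE 8f's input for the eigen-property).

presearch: functoriality bookkeeping (NSW I §5 Prop. 1.5.2–1.5.4; Serre, *Local Fields* VII §5 Prop. 3 "inner automorphisms act trivially");
JLK 2011 §4.2 (the `Λ`-action by conjugation). beyond-print theorem: no.

References: J. Neukirch, A. Schmidt, K. Wingberg (2008) I §5; J.-P. Serre, *Local Fields* (1979) VII §5; J. Johnson-Leung, G. Kings (2011) §4.2.
-/

noncomputable section

open scoped Classical

-- the summit namespace `Summit.BirchSwinnertonDyer.BirchSwinnertonDyer` repeats the problem name by design (D-0017)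
set_option linter.dupNamespace false
set_option autoImplicit false

open scoped NumberField
open Field IsDedekindDomain
open Literature.NumberTheory.GaloisRepresentations Literature.NumberTheory.GaloisRepresentations.DiscreteGaloisModule
open Literature.NumberTheory.EllipticCurves
open Literature.NumberTheory.ComplexMultiplication.EllipticUnits
open Literature.NumberTheory.ComplexMultiplication.EllipticUnits.JohnsonLeungKings2011

namespace Summit.BirchSwinnertonDyer.BirchSwinnertonDyer.Theorems.PrintCf2.RowTwo

variable {K : Type} [Field K] [NumberField K] (p : ℕ) [Fact p.Prime] (S : Set (HeightOneSpectrum (𝓞 K)))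
  (θ : absoluteGaloisGroup K →ₜ* ℤ_[p]ˣ) (k : ℕ) {U V : Subgroup (absoluteGaloisGroup K)}

/-! ## §1. Restriction versus reduction and conjugation -/

omit [NumberField K] in
/-- **`red ∘ res = res ∘ red`** on `H¹(·, μ_{p^{k+1}} ⊗ θ′) → H¹(·, μ_{p^k} ⊗ θ′)` (both composites are the pullback of a cocycle along `U_S ↪ V_S`
followed by `ζ ↦ ζ^p`). [cite: NeukirchSchmidtWingberg2008, I §5 Prop. 1.5.2] [cite: Kato2004Asterisque, §8.2 (p. 180)] -/
theorem levelRed_resLe (h : U ≤ V) (c : levelCoh p S θ V (k + 1) 1) :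
    levelRed p S θ U k 1 (resLe (coeffGS p S θ (k + 1)).toTopRep (imGS_le_of_le S h) 1 c) =
      resLe (coeffGS p S θ k).toTopRep (imGS_le_of_le S h) 1 (levelRed p S θ V k 1 c) := by
  obtain ⟨φ₀, rfl⟩ := oneCocycleClass_surjective _ c
  let X₁ := (coeffGS p S θ (k + 1)).toTopRep
  let X₀ := (coeffGS p S θ k).toTopRep
  let φ : contOneCocycles (subgroupRep X₁ (imGS S V)) := φ₀
  -- `res` then `red`
  let ψ₁ : contOneCocycles (subgroupRep X₁ (imGS S U)) :=
    contOneCocycles.pullback (subgroupInclusion (imGS_le_of_le S h)) (TopRep.ofHom ⟨ContinuousLinearMap.id ℤ X₁, fun _ => rfl⟩) φ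
  have e1 : resLe X₁ (imGS_le_of_le S h) 1 (oneCocycleClass (subgroupRep X₁ (imGS S V)) φ) =
      oneCocycleClass (subgroupRep X₁ (imGS S U)) ψ₁ := resLe_oneCocycleClass X₁ (imGS_le_of_le S h) φ
  let ψ₁' : contOneCocycles (levelRep p S θ U (k + 1)).toTopRep := ψ₁
  have e2 : levelRed p S θ U k 1 (oneCocycleClass (levelRep p S θ U (k + 1)).toTopRep ψ₁') =
      oneCocycleClass (levelRep p S θ U k).toTopRep
        (contOneCocycles.pullback (ContinuousMonoidHom.id _) (levelRedHom p S θ U k) ψ₁') := by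
    rw [levelRed_apply, map_oneCocycleClass]
  -- `red` then `res`
  have e3 : levelRed p S θ V k 1 (oneCocycleClass (levelRep p S θ V (k + 1)).toTopRep φ₀) =
      oneCocycleClass (levelRep p S θ V k).toTopRep
        (contOneCocycles.pullback (ContinuousMonoidHom.id _) (levelRedHom p S θ V k) φ₀) := by
    rw [levelRed_apply, map_oneCocycleClass]
  let ψ₃ : contOneCocycles (subgroupRep X₀ (imGS S V)) :=
    contOneCocycles.pullback (ContinuousMonoidHom.id _) (levelRedHom p S θ V k) φ₀
  have e4 : resLe X₀ (imGS_le_of_le S h) 1 (oneCocycleClass (subgroupRep X₀ (imGS S V)) ψ₃) =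
      oneCocycleClass (subgroupRep X₀ (imGS S U))
        (contOneCocycles.pullback (subgroupInclusion (imGS_le_of_le S h)) (TopRep.ofHom ⟨ContinuousLinearMap.id ℤ X₀, fun _ => rfl⟩) ψ₃) :=
    resLe_oneCocycleClass X₀ (imGS_le_of_le S h) ψ₃
  have e5 : (contOneCocycles.pullback (ContinuousMonoidHom.id _) (levelRedHom p S θ U k) ψ₁' :
      contOneCocycles (subgroupRep X₀ (imGS S U))) =
      contOneCocycles.pullback (subgroupInclusion (imGS_le_of_le S h)) (TopRep.ofHom ⟨ContinuousLinearMap.id ℤ X₀, fun _ => rfl⟩) ψ₃ :=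
    Subtype.ext (ContinuousMap.ext fun _ ↦ rfl)
  exact (congrArg (levelRed p S θ U k 1) e1).trans (e2.trans ((congrArg _ e5).trans (e4.symm.trans (congrArg _ e3.symm))))

omit [NumberField K] in
/-- **`res (δ·c) = δ·(res c)`** for `U, V ⊴ Γ_K`, `U ≤ V`, `δ ∈ Γ_K` (the tree's `Kato2004.resLe_conjMap` in ty2's currency).
[cite: NeukirchSchmidtWingberg2008, I §5 Prop. 1.5.4] -/
theorem levelConj_resLe [U.Normal] [V.Normal] (h : U ≤ V) (δ : absoluteGaloisGroup K) (c : levelCoh p S θ V k 1) :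
    resLe (coeffGS p S θ k).toTopRep (imGS_le_of_le S h) 1 (levelConj p S θ V k 1 δ c) =
      levelConj p S θ U k 1 δ (resLe (coeffGS p S θ k).toTopRep (imGS_le_of_le S h) 1 c) := by
  haveI : (imGS S U).Normal := Subgroup.Normal.map inferInstance _ (toUnramifiedQuot_surjective K S)
  haveI : (imGS S V).Normal := Subgroup.Normal.map inferInstance _ (toUnramifiedQuot_surjective K S)
  rw [levelConj_apply, levelConj_apply]
  exact Kato2004.resLe_conjMap (coeffGS p S θ k).toTopRep (imGS_le_of_le S h) (toUnramifiedQuot K S δ) c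

omit [NumberField K] in
/-- **`δ ∈ V` acts trivially on `H¹(V_S, μ_{p^k} ⊗ θ′)`** (inner automorphisms; Serre VII §5 Prop. 3, the tree's `conjMap_one_apply_of_mem`).
[cite: SerreLocalFields1979, VII §5 Prop. 3] -/
theorem levelConj_eq_self_of_mem [V.Normal] {δ : absoluteGaloisGroup K} (hδ : δ ∈ V) (c : levelCoh p S θ V k 1) :
    levelConj p S θ V k 1 δ c = c := by
  haveI : (imGS S V).Normal := Subgroup.Normal.map inferInstance _ (toUnramifiedQuot_surjective K S)
  rw [levelConj_apply]
  exact conjMap_one_apply_of_mem (coeffGS p S θ k).toTopRep (imGS S V) ⟨toUnramifiedQuot K S δ, Subgroup.mem_map_of_mem _ hδ⟩ c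

omit [NumberField K] in
/-- **The restriction to `U` of a class of `V` is `V`-invariant**: `δ·(res c) = res c` for `δ ∈ V`. [cite: SerreLocalFields1979, VII §5 Prop. 3] -/
theorem levelConj_resLe_eq_self_of_mem [U.Normal] [V.Normal] (h : U ≤ V) {δ : absoluteGaloisGroup K} (hδ : δ ∈ V)
    (c : levelCoh p S θ V k 1) :
    levelConj p S θ U k 1 δ (resLe (coeffGS p S θ k).toTopRep (imGS_le_of_le S h) 1 c) =
      resLe (coeffGS p S θ k).toTopRep (imGS_le_of_le S h) 1 c := by
  rw [← levelConj_resLe p S θ k h, levelConj_eq_self_of_mem p S θ k hδ]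

omit [NumberField K] in
/-- **The conjugation action is multiplicative**: `(γγ′)·c = γ·(γ′·c)` on `H¹` (tree `conjMap_mul_apply_one`). [cite: SerreLocalFields1979, VII §5] -/
theorem levelConj_mul [U.Normal] (γ γ' : absoluteGaloisGroup K) (c : levelCoh p S θ U k 1) :
    levelConj p S θ U k 1 (γ * γ') c = levelConj p S θ U k 1 γ (levelConj p S θ U k 1 γ' c) := by
  haveI : (imGS S U).Normal := Subgroup.Normal.map inferInstance _ (toUnramifiedQuot_surjective K S)
  rw [levelConj_apply, levelConj_apply, levelConj_apply, map_mul]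
  exact conjMap_mul_apply_one (coeffGS p S θ k).toTopRep (imGS S U) _ _ c

/-! ## §2. `(1+T_i)^M` acts on the layers as `conj_{γ_i^M}` -/

section Pins

variable (κ₁ κ₂ : ZpExtension K p) (𝔣 : Ideal (𝓞 K)) {γ₁ γ₂ : absoluteGaloisGroup K} (I : IwasawaCohomologyData p κ₁ κ₂ γ₁ γ₂ θ 𝔣 1)

/-- **`I.proj n k ((1+T₁)^M • h) = conj_{γ₁^M} (I.proj n k h)`** — pin (P5) `T₁ ↦ conj_{γ₁} − 1` iterated. [cite: JohnsonLeungKings2011, §4.2 (arXiv p0012:L109–112)] -/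
theorem proj_one_add_X_pow_smul (n k M : ℕ) (h : I.H) :
    I.proj n k (((1 : IwasawaAlgebra₂ p) + PowerSeries.X) ^ M • h) = layerConj p κ₁ κ₂ θ 𝔣 n k 1 (γ₁ ^ M) (I.proj n k h) := by
  induction M with
  | zero =>
    rw [pow_zero, one_smul, pow_zero]
    exact (levelConj_eq_self_of_mem p (suppPF p 𝔣) θ k (Subgroup.one_mem _) _).symm
  | succ M ih =>
    rw [pow_succ', mul_smul, add_smul, one_smul, map_add, I.proj_T₁_smul, ih, add_sub_cancel, pow_succ']
    exact (levelConj_mul p (suppPF p 𝔣) θ k γ₁ (γ₁ ^ M) _).symm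

/-- **`I.proj n k ((1+T₂)^M • h) = conj_{γ₂^M} (I.proj n k h)`** (`T₂ = C X`) — pin (P6) iterated. [cite: JohnsonLeungKings2011, §4.2 (arXiv p0012:L109–112)] -/
theorem proj_one_add_CX_pow_smul (n k M : ℕ) (h : I.H) :
    I.proj n k (((1 : IwasawaAlgebra₂ p) + PowerSeries.C (PowerSeries.X : IwasawaAlgebra p)) ^ M • h) =
      layerConj p κ₁ κ₂ θ 𝔣 n k 1 (γ₂ ^ M) (I.proj n k h) := by
  induction M with
  | zero =>
    rw [pow_zero, one_smul, pow_zero]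
    exact (levelConj_eq_self_of_mem p (suppPF p 𝔣) θ k (Subgroup.one_mem _) _).symm
  | succ M ih =>
    rw [pow_succ', mul_smul, add_smul, one_smul, map_add, I.proj_T₂_smul, ih, add_sub_cancel, pow_succ']
    exact (levelConj_mul p (suppPF p 𝔣) θ k γ₂ (γ₂ ^ M) _).symm

/-- **`(1+T₁)^M − 1` acts on the layer `(n,k)` as `conj_{γ₁^M} − 1`.** [cite: JohnsonLeungKings2011, §4.2 (arXiv p0012:L109–112)] -/
theorem proj_one_add_X_pow_sub_one_smul (n k M : ℕ) (h : I.H) :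
    I.proj n k ((((1 : IwasawaAlgebra₂ p) + PowerSeries.X) ^ M - 1) • h) =
      layerConj p κ₁ κ₂ θ 𝔣 n k 1 (γ₁ ^ M) (I.proj n k h) - I.proj n k h := by
  rw [sub_smul, one_smul, map_sub, proj_one_add_X_pow_smul]

/-- **`(1+T₂)^M − 1` acts on the layer `(n,k)` as `conj_{γ₂^M} − 1`.** [cite: JohnsonLeungKings2011, §4.2 (arXiv p0012:L109–112)] -/
theorem proj_one_add_CX_pow_sub_one_smul (n k M : ℕ) (h : I.H) :
    I.proj n k ((((1 : IwasawaAlgebra₂ p) + PowerSeries.C (PowerSeries.X : IwasawaAlgebra p)) ^ M - 1) • h) =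
      layerConj p κ₁ κ₂ θ 𝔣 n k 1 (γ₂ ^ M) (I.proj n k h) - I.proj n k h := by
  rw [sub_smul, one_smul, map_sub, proj_one_add_CX_pow_smul]

/-! ## §3. The restricted towers of a pinned element -/

/-- **`k ↦ res_U (I.proj n k h)` is a `k`-tower** (`U ≤ Gal(K̄/K̃_n)`): `red (res (I.proj n (k+1) h)) = res (I.proj n k h)` ((P2) + §1).
[cite: JohnsonLeungKings2011, Def. 4.2 (94) (arXiv p0012:L94)] [cite: Kato2004Asterisque, §8.2 (p. 180)] -/
theorem levelRed_resLe_proj (n : ℕ) (hU : U ≤ JohnsonLeungKings2011.pairLayerSubgroup κ₁ κ₂ n) (h : I.H) :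
    levelRed p (suppPF p 𝔣) θ U k 1 (resLe (coeffGS p (suppPF p 𝔣) θ (k + 1)).toTopRep (imGS_le_of_le (suppPF p 𝔣) hU) 1 (I.proj n (k + 1) h)) =
      resLe (coeffGS p (suppPF p 𝔣) θ k).toTopRep (imGS_le_of_le (suppPF p 𝔣) hU) 1 (I.proj n k h) := by
  rw [levelRed_resLe p (suppPF p 𝔣) θ k hU, ← I.proj_red n k h]
  rfl

/-- **`res_U (I.proj n k h)` is invariant under `Gal(K̄/K̃_n)`** (`U ⊴ Γ_K`, `U ≤ Gal(K̄/K̃_n)`): `δ·res(I.proj n k h) = res(I.proj n k h)` for every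
`δ ∈ Gal(K̄/K̃_n)` — in particular for the inertia elements at the places `𝔩 ∣ 𝔣`, `𝔩 ∤ p` (FILE 8c's `hram`) and for `Gal(K̄/K̃_∞)` (the eigen-property
of FILE 8f). [cite: SerreLocalFields1979, VII §5 Prop. 3] -/
theorem levelConj_resLe_proj_eq_self [U.Normal] (n : ℕ) (hU : U ≤ JohnsonLeungKings2011.pairLayerSubgroup κ₁ κ₂ n)
    {δ : absoluteGaloisGroup K} (hδ : δ ∈ JohnsonLeungKings2011.pairLayerSubgroup κ₁ κ₂ n) (h : I.H) :
    levelConj p (suppPF p 𝔣) θ U k 1 δ (resLe (coeffGS p (suppPF p 𝔣) θ k).toTopRep (imGS_le_of_le (suppPF p 𝔣) hU) 1 (I.proj n k h)) =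
      resLe (coeffGS p (suppPF p 𝔣) θ k).toTopRep (imGS_le_of_le (suppPF p 𝔣) hU) 1 (I.proj n k h) := by
  haveI : (JohnsonLeungKings2011.pairLayerSubgroup κ₁ κ₂ n).Normal := inferInstance
  exact levelConj_resLe_eq_self_of_mem p (suppPF p 𝔣) θ k hU hδ _

end Pins

end Summit.BirchSwinnertonDyer.BirchSwinnertonDyer.Theorems.PrintCf2.RowTwo

end
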